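import Summits.ValiantsHypothesis.ValiantsHypothesis.Theorems.BarrierLeverChowBenchmarkPairsBlockPeelRuns
import Summits.ValiantsHypothesis.ValiantsHypothesis.Theorems.BarrierLeverChowBenchmarkPairsDirichletTables

/-!
# Route BarrierLever — item 22038 `ChowBenchmarkPairs`, line `moore-peel`: the BLOCK LADDER — CONJECTURE P′ UP TO A
# HEIGHT, and node #1 for every `h ≤ 724` from FIVE explicit symbolic block determinants (`h ≤ 363` from ONE)

Helper file (`--supports stmt-ValiantsHypothesis-22038`; cell valiant-natproofs, rung V4, 𝒟-side benchmark of
record, line `moore_peel`, planner kernel targets K1–K3 (HOME/STATUS.md l.1746); seat val-np-p4 gen 29).  Closes NO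
item.  One definition (`Stmt.conjPrefixUpTo H`, a `Prop`: CONJECTURE P′ of `…BlockPeelRuns` restricted to blocks
ending at stages `≤ H`).

WHY.  The block peel theorem (`…BlockPeel`) turns a tiling of `[1, h]` by blocks with nonzero symbolic determinant
into `SegmentMeanValueAt h`; THEOREM W (`…DirichletSplit`, `…DirichletTables`: the 41 bad stages `≤ 5000`) says which
stages are good singles.  This file spells out WHAT EXACTLY must be certified to push node #1 beyond the by-name
frontier `h ≤ 182` (p690790): below `725` the bad stages `183, 364, 444, 573, 628` are isolated, so

* `segmentMeanValueAt_of_le_363` — `det J^{!}(182,2)(Λ) ≠ 0` in `ℤ[Λ_0,Λ_1]` ALONE gives `SegmentMeanValueAt h` for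
  every `h ≤ 363` (one `365 × 365` symbolic determinant; numerically nonzero, kit j323569; not decide-able);
* `segmentMeanValueAt_of_le_724` — the five determinants `det J^{!}(b-1,2) ≠ 0`, `b ∈ {183, 364, 444, 573, 628}`,
  give `SegmentMeanValueAt h` for every `h ≤ 724` (all five numerically nonzero, kit j323569 part A).

Tools: `kernelPoisedAt_factorial_of_conjPrefixUpTo` (the arrow of `…BlockPeelRuns` with the bound tracked),
`conjPrefixUpTo_of_isolated` (when every bad stage `≤ H` is isolated, P′ up to `H` reduces to the 2-blocks `{b-1, b}`),
`isolated_le_724` / `bad_le_724` (THEOREM W's table, by `decide`).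

WHAT THIS IS NOT: no unconditional extension of node #1 (the determinant hypotheses are numerically verified, not
kernel-checked); nothing on crux stmt-ValiantsHypothesis-14610 or on `VP` versus `VNP`.
-/

set_option linter.dupNamespace false

namespace Summit.ValiantsHypothesis.ValiantsHypothesis.Theorems.BarrierLever.MoorePeel

open Polynomial Finset

/-- **CONJECTURE P′ up to height `H`**: `Stmt.conjPrefix` of `…BlockPeelRuns` for blocks `{g, …, b}` with `b ≤ H`. -/
def Stmt.conjPrefixUpTo (H : ℕ) : Prop :=
  ∀ g b : ℕ, 1 ≤ g → g < b → b ≤ H → (peelMatrix g).det ≠ 0 → (∀ i, g < i → i ≤ b → (peelMatrix i).det = 0) →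
    (blockMatrix Nat.factorial g (b + 1 - g)
      (fun s : Fin (b + 1 - g) => (MvPolynomial.X s : MvPolynomial (Fin (b + 1 - g)) ℤ))).det ≠ 0

/-- P′ implies P′ up to every height. -/
theorem conjPrefixUpTo_of_conjPrefix (hP : Stmt.conjPrefix) (H : ℕ) : Stmt.conjPrefixUpTo H :=
  fun g b h1 hgb _ hg hbad => hP g b h1 hgb hg hbad

/-- **THE ARROW, with the bound tracked**: CONJECTURE P′ up to `H` gives `KernelPoisedAt k! h` for every `h ≤ H`
(the tiling of `…BlockPeelRuns` only uses blocks ending at stages `≤ h`). -/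
theorem kernelPoisedAt_factorial_of_conjPrefixUpTo (H : ℕ) (hP : Stmt.conjPrefixUpTo H) (h : ℕ) (hhH : h ≤ H) :
    KernelPoisedAt Nat.factorial h := by
  classical
  -- the cut points: good stages of `[1, h]`, and `h + 1`
  set S : Finset ℕ := (Finset.range (h + 2)).filter
    (fun c => (1 ≤ c ∧ c ≤ h ∧ (peelMatrix c).det ≠ 0) ∨ c = h + 1) with hS
  have hmemS : ∀ c, c ∈ S ↔ (1 ≤ c ∧ c ≤ h ∧ (peelMatrix c).det ≠ 0) ∨ c = h + 1 := by
    intro c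
    rw [hS, Finset.mem_filter, Finset.mem_range]
    constructor
    · exact fun hc => hc.2
    · intro hc
      refine ⟨?_, hc⟩
      rcases hc with hc | hc <;> omega
  have htop : h + 1 ∈ S := (hmemS _).mpr (Or.inr rfl)
  have hone : 1 ∈ S := by
    rcases Nat.eq_zero_or_pos h with hz | hpos
    · exact (hmemS _).mpr (Or.inr (by omega))
    · exact (hmemS _).mpr (Or.inl ⟨le_rfl, hpos, det_peelMatrix_ne_zero_of_le_182_by_W 1 (by norm_num) le_rfl⟩)
  have hge1 : ∀ c ∈ S, 1 ≤ c := fun c hc => by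
    rcases (hmemS c).mp hc with hc | hc <;> omega
  have hle : ∀ c ∈ S, c ≤ h + 1 := fun c hc => by
    rcases (hmemS c).mp hc with hc | hc <;> omega
  set k := S.card with hk
  have hkpos : 0 < k := Finset.card_pos.mpr ⟨1, hone⟩
  set emb := S.orderEmbOfFin hk.symm with hemb
  set a : ℕ → ℕ := fun q => if hq : q < k then emb ⟨q, hq⟩ else h + 1 with ha
  have ha_of_lt : ∀ q (hq : q < k), a q = emb ⟨q, hq⟩ := fun q hq => by simp only [ha, dif_pos hq]
  have hsurj : ∀ x ∈ S, ∃ j : Fin k, emb j = x := by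
    intro x hx
    have : x ∈ Set.range emb := by rw [hemb, Finset.range_orderEmbOfFin]; exact hx
    exact this
  have hmono : ∀ q, q + 1 < k → a q < a (q + 1) := by
    intro q hq
    rw [ha_of_lt q (by omega), ha_of_lt (q + 1) hq]
    exact emb.strictMono (Fin.mk_lt_mk.mpr (Nat.lt_succ_self q))
  have hmem_a : ∀ q (hq : q < k), a q ∈ S := fun q hq => by
    rw [ha_of_lt q hq]
    exact Finset.orderEmbOfFin_mem S hk.symm _
  -- no cut point strictly between two consecutive cut points
  have hgap : ∀ q (hq : q + 1 < k) (x : ℕ), a q < x → x < a (q + 1) → x ∉ S := by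
    intro q hq x h1 h2 hx
    obtain ⟨j, hj⟩ := hsurj x hx
    rw [ha_of_lt q (by omega)] at h1
    rw [ha_of_lt (q + 1) hq] at h2
    rw [← hj] at h1 h2
    have h1' := emb.lt_iff_lt.mp h1
    have h2' := emb.lt_iff_lt.mp h2
    rw [Fin.lt_def] at h1' h2'
    simp only at h1' h2'
    omega
  refine kernelPoisedAt_of_blocks Nat.factorial (fun k => Nat.factorial_ne_zero k) h (k - 1) a ?_ ?_ ?_ ?_
  · -- `a 0 = min S = 1`
    rw [ha_of_lt 0 hkpos]
    show emb ⟨0, hkpos⟩ = 1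
    rw [hemb, Finset.orderEmbOfFin_zero hk.symm hkpos]
    exact le_antisymm (Finset.min'_le S 1 hone) (Finset.le_min' _ _ _ fun c hc => hge1 c hc)
  · -- `a (k-1) = max S = h + 1`
    rw [ha_of_lt (k - 1) (by omega)]
    have e : (⟨k - 1, by omega⟩ : Fin k) = ⟨k - 1, Nat.sub_lt hkpos (Nat.succ_pos 0)⟩ := rfl
    rw [e, hemb, Finset.orderEmbOfFin_last hk.symm hkpos]
    exact le_antisymm (Finset.max'_le _ _ _ fun c hc => hle c hc) (Finset.le_max' S (h + 1) htop)
  · -- strictly increasing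
    intro q hq
    exact hmono q (by omega)
  · -- every block is a single at a good stage or a P′-block
    intro q hq
    have hq1 : q + 1 < k := by omega
    have hlt := hmono q hq1
    have hcS := hmem_a q (by omega)
    have hc'le : a (q + 1) ≤ h + 1 := hle _ (hmem_a (q + 1) hq1)
    have hgood : 1 ≤ a q ∧ a q ≤ h ∧ (peelMatrix (a q)).det ≠ 0 := by
      rcases (hmemS _).mp hcS with hc | hc
      · exact hc
      · exfalso; omega
    by_cases hsingle : a (q + 1) = a q + 1
    · rw [hsingle, Nat.add_sub_cancel_left]
      exact det_blockMatrix_factorial_one_ne_zero (a q) hgood.2.2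
    · have hb : a q < a (q + 1) - 1 := by omega
      have hbad : ∀ i, a q < i → i ≤ a (q + 1) - 1 → (peelMatrix i).det = 0 := by
        intro i h1 h2
        by_contra hne
        exact hgap q hq1 i h1 (by omega) ((hmemS i).mpr (Or.inl ⟨by omega, by omega, hne⟩))
      have e : a (q + 1) - a q = a (q + 1) - 1 + 1 - a q := by omega
      exact det_blockMatrix_X_ne_zero_of_eq' Nat.factorial (a q) e
        (hP (a q) (a (q + 1) - 1) hgood.1 hb (by omega) hgood.2.2 hbad)


/-- **Isolated bad stages**: if below `H` every bad stage is followed by a good one, CONJECTURE P′ up to `H` reduces to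
the 2-blocks `{b-1, b}` over the bad stages `b ≤ H` (`det J^{!}(b-1, 2)(Λ_0, Λ_1) ≠ 0`). -/
theorem conjPrefixUpTo_of_isolated (H : ℕ)
    (hiso : ∀ b, b + 1 ≤ H → (peelMatrix b).det = 0 → (peelMatrix (b + 1)).det ≠ 0)
    (cert : ∀ b, 2 ≤ b → b ≤ H → (peelMatrix b).det = 0 →
      (blockMatrix Nat.factorial (b - 1) 2 (fun s : Fin 2 => (MvPolynomial.X s : MvPolynomial (Fin 2) ℤ))).det ≠ 0) :
    Stmt.conjPrefixUpTo H := by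
  intro g b h1 hgb hbH hg hbad
  -- the run `(g, b]` has length one: otherwise `g+1` and `g+2` are both bad
  have hb : b = g + 1 := by
    by_contra hne
    have h2 : g + 2 ≤ b := by omega
    exact hiso (g + 1) (by omega) (hbad (g + 1) (by omega) (by omega)) (hbad (g + 2) (by omega) h2)
  subst hb
  have e : g + 1 + 1 - g = 2 := by omega
  exact det_blockMatrix_X_ne_zero_of_eq' Nat.factorial g e
    (by have := cert (g + 1) (by omega) hbH (hbad (g + 1) (by omega) le_rfl); rwa [Nat.add_sub_cancel] at this)

/-- THEOREM W's table: below `725` every bad stage is followed by a good one. -/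
theorem isolated_le_724 : ∀ b ∈ List.range 724, b ∈ badStagesLe5000 → b + 1 ∉ badStagesLe5000 := by
  decide +kernel

/-- THEOREM W's table: the bad stages `≤ 724` are `183, 364, 444, 573, 628`. -/
theorem bad_le_724 : ∀ b ∈ List.range 725, b ∈ badStagesLe5000 →
    b = 183 ∨ b = 364 ∨ b = 444 ∨ b = 573 ∨ b = 628 := by
  decide +kernel

/-- **Node #1 for every `h ≤ 724` from five symbolic 2-block determinants** (the bad stages `183, 364, 444, 573,
628` of THEOREM W, each absorbed by its predecessor). -/
theorem kernelPoisedAt_factorial_of_le_724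
    (h183 : (blockMatrix Nat.factorial 182 2 (fun s : Fin 2 => (MvPolynomial.X s : MvPolynomial (Fin 2) ℤ))).det ≠ 0)
    (h364 : (blockMatrix Nat.factorial 363 2 (fun s : Fin 2 => (MvPolynomial.X s : MvPolynomial (Fin 2) ℤ))).det ≠ 0)
    (h444 : (blockMatrix Nat.factorial 443 2 (fun s : Fin 2 => (MvPolynomial.X s : MvPolynomial (Fin 2) ℤ))).det ≠ 0)
    (h573 : (blockMatrix Nat.factorial 572 2 (fun s : Fin 2 => (MvPolynomial.X s : MvPolynomial (Fin 2) ℤ))).det ≠ 0)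
    (h628 : (blockMatrix Nat.factorial 627 2 (fun s : Fin 2 => (MvPolynomial.X s : MvPolynomial (Fin 2) ℤ))).det ≠ 0)
    (h : ℕ) (hh : h ≤ 724) : KernelPoisedAt Nat.factorial h := by
  refine kernelPoisedAt_factorial_of_conjPrefixUpTo 724 (conjPrefixUpTo_of_isolated 724 ?_ ?_) h hh
  · intro b hb hbad hbad1
    have h1 : 1 ≤ b := by
      by_contra h0
      have : b = 0 := by omega
      subst this
      exact absurd hbad (by decide)
    have hmem : b ∈ badStagesLe5000 := (det_peelMatrix_eq_zero_iff_mem_of_le_5000 b h1 (by omega)).mp hbad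
    have hmem1 : b + 1 ∈ badStagesLe5000 :=
      (det_peelMatrix_eq_zero_iff_mem_of_le_5000 (b + 1) (by omega) (by omega)).mp hbad1
    exact isolated_le_724 b (List.mem_range.mpr (by omega)) hmem hmem1
  · intro b h2 hbH hbad
    have hmem : b ∈ badStagesLe5000 := (det_peelMatrix_eq_zero_iff_mem_of_le_5000 b (by omega) (by omega)).mp hbad
    rcases bad_le_724 b (List.mem_range.mpr (by omega)) hmem with rfl | rfl | rfl | rfl | rfl
    · exact h183
    · exact h364
    · exact h444
    · exact h573
    · exact h628

/-- THEOREM W's table: the only bad stage `≤ 363` is `183`. -/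
theorem bad_le_363 : ∀ b ∈ List.range 364, b ∈ badStagesLe5000 → b = 183 := by
  decide +kernel

/-- **Node #1 for every `h ≤ 363` from ONE symbolic determinant**: `det J^{!}(182,2)(Λ_0,Λ_1) ≠ 0` (the tied block
`{182, 183}`; a `365 × 365` matrix over `ℤ[Λ_0,Λ_1]`) gives `KernelPoisedAt k! h` for all `h ≤ 363`. -/
theorem kernelPoisedAt_factorial_of_le_363
    (h183 : (blockMatrix Nat.factorial 182 2 (fun s : Fin 2 => (MvPolynomial.X s : MvPolynomial (Fin 2) ℤ))).det ≠ 0)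
    (h : ℕ) (hh : h ≤ 363) : KernelPoisedAt Nat.factorial h := by
  refine kernelPoisedAt_factorial_of_conjPrefixUpTo 363 (conjPrefixUpTo_of_isolated 363 ?_ ?_) h hh
  · intro b hb hbad hbad1
    have h1 : 1 ≤ b := by
      by_contra h0
      have : b = 0 := by omega
      subst this
      exact absurd hbad (by decide)
    have hmem : b ∈ badStagesLe5000 := (det_peelMatrix_eq_zero_iff_mem_of_le_5000 b h1 (by omega)).mp hbad
    have hmem1 : b + 1 ∈ badStagesLe5000 :=
      (det_peelMatrix_eq_zero_iff_mem_of_le_5000 (b + 1) (by omega) (by omega)).mp hbad1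
    exact isolated_le_724 b (List.mem_range.mpr (by omega)) hmem hmem1
  · intro b h2 hbH hbad
    have hmem : b ∈ badStagesLe5000 := (det_peelMatrix_eq_zero_iff_mem_of_le_5000 b (by omega) (by omega)).mp hbad
    obtain rfl := bad_le_363 b (List.mem_range.mpr (by omega)) hmem
    exact h183

/-- **`SegmentMeanValueAt h` for every `h ≤ 363` from ONE symbolic block determinant**, verbatim (node #1's
statement on `[0, 363]` modulo `det J^{!}(182,2) ≠ 0`; numerically nonzero — kit j323569 — not kernel-checked). -/
theorem segmentMeanValueAt_of_le_363
    (h183 : (blockMatrix Nat.factorial 182 2 (fun s : Fin 2 => (MvPolynomial.X s : MvPolynomial (Fin 2) ℤ))).det ≠ 0)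
    (h : ℕ) (hh : h ≤ 363) :
    ∀ (r : ℕ) (u : Fin r → Finset (Fin h)), Function.Injective u → (∀ i, (u i).card ≤ 2) →
      (∀ S : Finset (Fin h), S.card ≤ 2 → ∃ i, u i = S) →
      ∃ P : Fin h → Fin h → ℂ,
        (Matrix.of fun i j : Fin r =>
          ∑ g : (↥(benchCols h r j) → ↥(u i)), (∏ c : ↥(benchCols h r j), P (g c) c) *
            ∏ a : ↥(u i),
              ((Finset.univ.filter fun c : ↥(benchCols h r j) => g c = a).card.factorial : ℂ)).det ≠ 0 :=
  kernelPoisedAt_factorial_of_le_363 h183 h hh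

/-- **`SegmentMeanValueAt h` for every `h ≤ 724` from five symbolic 2-block determinants**, verbatim. -/
theorem segmentMeanValueAt_of_le_724
    (h183 : (blockMatrix Nat.factorial 182 2 (fun s : Fin 2 => (MvPolynomial.X s : MvPolynomial (Fin 2) ℤ))).det ≠ 0)
    (h364 : (blockMatrix Nat.factorial 363 2 (fun s : Fin 2 => (MvPolynomial.X s : MvPolynomial (Fin 2) ℤ))).det ≠ 0)
    (h444 : (blockMatrix Nat.factorial 443 2 (fun s : Fin 2 => (MvPolynomial.X s : MvPolynomial (Fin 2) ℤ))).det ≠ 0)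
    (h573 : (blockMatrix Nat.factorial 572 2 (fun s : Fin 2 => (MvPolynomial.X s : MvPolynomial (Fin 2) ℤ))).det ≠ 0)
    (h628 : (blockMatrix Nat.factorial 627 2 (fun s : Fin 2 => (MvPolynomial.X s : MvPolynomial (Fin 2) ℤ))).det ≠ 0)
    (h : ℕ) (hh : h ≤ 724) :
    ∀ (r : ℕ) (u : Fin r → Finset (Fin h)), Function.Injective u → (∀ i, (u i).card ≤ 2) →
      (∀ S : Finset (Fin h), S.card ≤ 2 → ∃ i, u i = S) →
      ∃ P : Fin h → Fin h → ℂ,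
        (Matrix.of fun i j : Fin r =>
          ∑ g : (↥(benchCols h r j) → ↥(u i)), (∏ c : ↥(benchCols h r j), P (g c) c) *
            ∏ a : ↥(u i),
              ((Finset.univ.filter fun c : ↥(benchCols h r j) => g c = a).card.factorial : ℂ)).det ≠ 0 :=
  kernelPoisedAt_factorial_of_le_724 h183 h364 h444 h573 h628 h hh

end Summit.ValiantsHypothesis.ValiantsHypothesis.Theorems.BarrierLever.MoorePeel
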